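import Summits.QuantumFields.YangMills.Theorems.UnitScaleTiltHalvingStepOfPillarsRoomStat
import Summits.QuantumFields.YangMills.Theorems.UnitScaleTiltProp7CritEL
import Summits.QuantumFields.YangMills.Theorems.UnitScaleTiltFlatOpsAdmAtMSAllL
import HarnessLib

/-!
# Route `UnitScaleTilt`, crux K1 child «MinimiserStabilityRegPr» (stmt-QuantumFields-19200), registered stub V2′ `stub_halvingStep` (v8∕v10 `BirthV10`) —
# **THE DOOR v3 IN STATIONARITY CURRENCY, FILE 2∕2 (★★OWNER RULING №30 (4)(a), LEAD-H RULING L-7 (a)): `RoomHalvingTextStat L` FROM THE THREE DISPLAYED TEXTS, AND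
# `RoomHalvingTextStat ⇒ RoomHalvingText`** — `halvingStep_of_rows_roomStat (hP2) (hP1room) (hCEstat) : ∀ L, RoomHalvingTextStat L` through FILE 1's
# ✓`HalvingStepOfPillarsRoomStat.roomHalvingStat_of_rows`, and the glue `roomHalvingText_of_stat` (LEAD-H L-7 (1): `IsCritical ⇒ Stat` is ✓`Prop7CritEL.deriv_comp_eq_zero_of_isCritR2`)

Cell `ym3-torus` (HUMAN RULING D-0037, YM ladder rung R3 — continuum SU(2) YM₃ on the torus is a RUNG, not the Clay problem), width seat `ym-ust-19200-w3` gen 5.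
`--supports stmt-QuantumFields-19200 --as helper`; def-free, 0 sorry, standard axioms.  The three texts are HYPOTHESES; nothing here claims the stub, the crux, the rung
or the mass gap.

THE ROOM-STUB TEXT IN STATIONARITY CURRENCY (LEAD-H L-7 (a) VERBATIM; displayed inline, no definition):
`RoomHalvingTextStat L := 1 < L → ∃ B₃ : ℝ, 4 < B₃ ∧ ∃ a₅ : ℝ, 0 < a₅ ∧ ∃ N : ℕ, ∀ (i : Idx L), N ≤ (i.1.1).L ^ ((i.1.1).m + i.1.2.1) → ∀ (ε₀ ε₁ : ℝ), 0 < ε₁ →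
∀ (V : (famX L i).Bdry) (U : (famX L i).Cfg), (famX L i).Reg7 ε₁ V → (famX L i).InU ε₀ U → (famX L i).InB V U → (∀ γ : ℝ → GaugeField ((i.1.1).P i.1.2.2) 0 SU(2),
γ 0 = U → (∀ t, γ t ∈ fibre i.1.1 ℰp i.1.2.1 i.1.2.2 i.2.2.le V) → (∀ b, DifferentiableAt ℝ (fun t => ↑(γ t b)) 0) → deriv (fun t => wilsonAction4 (γ t)) 0 = 0) → ε₀ ≤ a₅ →
(famX L i).InU (max (B₃ * ε₁) (ε₀ / 2)) U` — `RoomHalvingText` (door v2, ✓`HalvingStepOfPillarsRoomDoor`) with `(famX L i).IsCritical V U` replaced by STATIONARITY.  Since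
minimality over print's open regular fibre implies stationarity along fibre curves (✓`deriv_comp_eq_zero_of_isCritR2`, continuity from ✓`continuousAt_of_differentiableAt_bonds`),
`RoomHalvingTextStat L → RoomHalvingText L` (§8): door v3 is the STRONGER door, and the cover-lift target is `stub_of_roomHalvingStat : (∀ L, RoomHalvingTextStat L) → <stub>`
(★w3-20520 g5 FILE 1–3).

WHAT THIS FILE PROVES (no definition, no sorry):
* §6 `roomStubTextStat_of_roomHalvingStat` — FILE 1 §5's stationarity-currency room halving ⟹ `∀ L, RoomHalvingTextStat L` (member by member, definitional readings of the
  carrier; `U ∈ regFibrePr F n K _ ε₀ V` from `InB ∧ InU`, `0 < ε₀` from ✓`Prop8Iter.eps_pos_of_regPr`).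
* §7 ★★★ **`halvingStep_of_rows_roomStat (hP2) (hP1room) (hCEstat) : ∀ L, RoomHalvingTextStat L`** — THE DOOR v3 (binders: `hP2`, `hP1room` VERBATIM door v2 ✓p628950;
  `hCEstat` = door v2's `hCE` with `IsMinOn wilsonAction4 (regFibrePr F n K _ ε₀ V) U →` replaced by the stationarity clause — target of L4-Stat).
* §8 `roomHalvingText_of_stat : (∀ L, RoomHalvingTextStat L) → ∀ L, RoomHalvingText L` (the glue (1) of L-7).
* §9 ★★★ `halvingStep_of_rows_roomStat₂ (hP1room) (hCEstat) : ∀ L, RoomHalvingTextStat L` — door v3 with `hP2` discharged by ✓`FlatOpsAdmAtMSAllL.hP2_holds`.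
HONEST SCOPE.  Assembly only.  NOT a claim about the stub, the crux, the rung or the mass gap.

References: T. Bałaban, CMP **102** (1985) 277–309 [Balaban1985Variational] (111) p.294, (152)–(168) pp.301–304, Prop. 8 p.304, Sect. F p.300; CMP **99** (1985) 75–102
[Balaban1985RegularSpaces] Thm 2 p.83.
-/

set_option autoImplicit false

noncomputable section

open scoped BigOperators Matrix.Norms.L2Operator

namespace Summit.QuantumFields.YangMills.Theorems.HalvingStepOfPillarsRoomStatDoor

open Literature.MathematicalPhysics.QuantumFieldTheory.Balaban1983to89
open Literature.MathematicalPhysics.QuantumFieldTheory.Balaban1983to89.T3ContinuumYM3Torus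
open Literature.MathematicalPhysics.QuantumFieldTheory.Balaban1983to89.T3PrintedRegularMinimiser
open Literature.MathematicalPhysics.QuantumFieldTheory.Balaban1983to89.T3PrintedMinimiserExistence
open Literature.MathematicalPhysics.QuantumFieldTheory.Balaban1983to89.T3Thm1Carrier
open Literature.MathematicalPhysics.QuantumFieldTheory.Balaban1983to89.T3Thm1CarrierNative (IsCritR2)
open Literature.MathematicalPhysics.QuantumFieldTheory.Balaban1983to89.T3UnitLawDensityEML (ℰp)
open Literature.MathematicalPhysics.QuantumFieldTheory.Balaban1983to89.T3ConstrainedMinimiser (fibre)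
open Complex (I)
open B5Eq117TorusCarriers (Mk)
open B5Eq118OneStroke (iterBlockOf)
open B5Prop12FieldsLattice (distSite distSite_self)
open B6SectADomainsV1 (Domains)
open B6SectAOperatorsV1 (BondIdx SiteIdx)
open B7Prop1Explicit (expUnit)
open B7Eq92Concrete (mgauge)
open B8Ineq132 (BondTouches)
open B8Eq140Level (SideTouches sideTouches_mono Cond140)
open B8Eq143PlaqExpansion (pdiv)
open B8Eq146AExpansion (plaqCovDeriv)
open B8Eq184Proof (cfgExp)
open B8Thm2SetupTorus (cfgPull gaugePull pullDom)
open B10Eq27TorusAxialLog (pull unitsField toUField transl)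
open B11Eq115Space (levOf)
open LatticeFieldCalculus (bondAvgIter laplace diverg siteAvgIter)
open FlatCubeOpsText (Adm22 IsLevWeight FlatOpsAdmAtMS)
open FlatCubeSequenceAligned (cubeSeqMT3)
open FlatCubeSequenceAdm (adm22_cubeSeqMT3)
open FlatOpsLettersAssembly (flatH isFlatH_flatH)
open HalvingQuarterCubeSeq (inOm_top_of_dist)
open HalvingP1FlatPillar (DP1Clause P1FlatPillarAt P1FlatPillar)
open HalvingP1FlatPillarPrime (P1FlatPillarAt' P1FlatPillar' sideTouches_subset_cube0)
open HalvingStepOfPillars (layerChart_of_memberChart)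
open HalvingAssemblyInterior (siteClause_of_pieces_int)
open HalvingStepOfPillarsRoomStat (roomHalvingStat_of_rows)
open Prop7CritEL (deriv_comp_eq_zero_of_isCritR2 continuousAt_of_differentiableAt_bonds)
open FlatCubeSequenceAligned (cubeSetM)
open HalvingSitePackage (sitePackage_of_rows)
open Summit.QuantumFields.YangMills.Theorems.Prop8ChartDoubleBar (chartLogFlat)

/-! ## §6 The room-stub text in stationarity currency from the room halving -/

section Door


/-- **THE ROOM-STUB TEXT IN STATIONARITY CURRENCY FROM THE ROOM HALVING** (member by member; the carrier's `Reg7`∕`InU`∕`InB` at `famX L ⟨(F, n, K), _⟩` ARE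
`PlaqSmall`∕`RegPr`∕the (0.4)-fibre definitionally, so `U ∈ regFibrePr F n K _ ε₀ V` and the stationarity clause pass through verbatim).
[cite: Balaban1985Variational, Sect. F p.300 and p.304 before Prop. 8] -/
theorem roomStubTextStat_of_roomHalvingStat
    (H : ∀ L : ℕ, 1 < L → ∃ (N : ℕ) (B₃ a₅ : ℝ), 4 < B₃ ∧ 0 < a₅ ∧
      ∀ F : T3Family, F.L = L → ∀ (n K : ℕ) (hnK : n < K), N ≤ F.L ^ (F.m + n) →
        ∀ (ε₀ ε₁ : ℝ), 0 < ε₁ → 0 < ε₀ → ε₀ ≤ a₅ →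
          ∀ V : GaugeField (F.P n) 0 (Matrix.specialUnitaryGroup (Fin 2) ℂ), PlaqSmall ε₁ V →
            ∀ U ∈ regFibrePr F n K hnK.le ε₀ V,
              (∀ γ : ℝ → GaugeField (F.P K) 0 (Matrix.specialUnitaryGroup (Fin 2) ℂ), γ 0 = U → (∀ t, γ t ∈ fibre F ℰp n K hnK.le V) →
                (∀ b, DifferentiableAt ℝ (fun t => ((γ t b : Matrix.specialUnitaryGroup (Fin 2) ℂ) : Matrix (Fin 2) (Fin 2) ℂ)) 0) →
                  deriv (fun t => wilsonAction4 (γ t)) 0 = 0) →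
                RegPr F n K (max (B₃ * ε₁) (ε₀ / 2)) U) :
    ∀ (L : ℕ), 1 < L → ∃ B₃ : ℝ, 4 < B₃ ∧ ∃ a₅ : ℝ, 0 < a₅ ∧ ∃ N : ℕ,
      ∀ (i : Idx L), N ≤ (i.1.1).L ^ ((i.1.1).m + i.1.2.1) → ∀ (ε₀ ε₁ : ℝ), 0 < ε₁ → ∀ (V : (famX L i).Bdry) (U : (famX L i).Cfg),
        (famX L i).Reg7 ε₁ V → (famX L i).InU ε₀ U → (famX L i).InB V U →
        (∀ γ : ℝ → GaugeField ((i.1.1).P i.1.2.2) 0 (Matrix.specialUnitaryGroup (Fin 2) ℂ), γ 0 = U → (∀ t, γ t ∈ fibre i.1.1 ℰp i.1.2.1 i.1.2.2 i.2.2.le V) →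
          (∀ b, DifferentiableAt ℝ (fun t => ((γ t b : Matrix.specialUnitaryGroup (Fin 2) ℂ) : Matrix (Fin 2) (Fin 2) ℂ)) 0) →
            deriv (fun t => wilsonAction4 (γ t)) 0 = 0) → ε₀ ≤ a₅ →
          (famX L i).InU (max (B₃ * ε₁) (ε₀ / 2)) U := by
  intro L hL
  obtain ⟨N, B₃, a₅, hB₃, ha₅, h⟩ := H L hL
  refine ⟨B₃, hB₃, a₅, ha₅, N, ?_⟩
  rintro ⟨⟨F, n, K⟩, hF, hnK⟩ hN ε₀ ε₁ hε₁ V U hV hU hB hstat hε₀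
  -- the carrier's predicates, read natively (definitional)
  have hF' : F.L = L := hF
  have hnK' : n < K := hnK
  have hN' : N ≤ F.L ^ (F.m + n) := hN
  have hV' : PlaqSmall ε₁ V := hV
  have hU' : RegPr F n K ε₀ U := hU
  have hB' : U ∈ fibre F ℰp n K hnK'.le V := hB
  have hstat' : ∀ γ : ℝ → GaugeField (F.P K) 0 (Matrix.specialUnitaryGroup (Fin 2) ℂ), γ 0 = U → (∀ t, γ t ∈ fibre F ℰp n K hnK'.le V) →
      (∀ b, DifferentiableAt ℝ (fun t => ((γ t b : Matrix.specialUnitaryGroup (Fin 2) ℂ) : Matrix (Fin 2) (Fin 2) ℂ)) 0) →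
        deriv (fun t => wilsonAction4 (γ t)) 0 = 0 := hstat
  show RegPr F n K (max (B₃ * ε₁) (ε₀ / 2)) U
  have hε₀pos : 0 < ε₀ := Prop8Iter.eps_pos_of_regPr hU'
  have hUr : U ∈ regFibrePr F n K hnK'.le ε₀ V := (mem_regFibrePr_iff F).mpr ⟨hB', hU'⟩
  exact h F hF' n K hnK' hN' ε₀ ε₁ hε₁ hε₀pos hε₀ V hV' U hUr hstat'

/-! ## §7 The door v3 -/

/-- ★★★ **THE DOOR v3, STATIONARITY CURRENCY** (★★OWNER №30 (4)(a), LEAD-H L-7 (a)): from `hP2`, `hP1room` (door v2's, verbatim) and `hCEstat` (door v2's `hCE` with the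
minimiser premise replaced by stationarity along differentiable exact-fibre curves), THE ROOM-STUB TEXT IN STATIONARITY CURRENCY `RoomHalvingTextStat L` for every `L`.
[cite: Balaban1985Variational, (111) p.294, (152)-(168) pp.301-304, Prop. 8 p.304; Balaban1985RegularSpaces, Thm 2 p.83] -/
theorem halvingStep_of_rows_roomStat
    (hP2 : ∀ L : ℕ, Odd L → 1 < L → ∃ (R₀ M₀ : ℕ) (B₀ δ₀ B₃ : ℝ), 0 < B₀ ∧ 0 < δ₀ ∧ 0 < B₃ ∧ FlatOpsAdmAtMS L R₀ M₀ B₀ δ₀ B₃)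
    (hP1room : ∀ L : ℕ, Odd L → 1 < L → ∃ (Mₚ Rₚ : ℕ), ∀ (R M aₑ S : ℕ) (hM : 1 ≤ M), M = L ^ aₑ → Mₚ ≤ M → Rₚ ≤ R → R * M ≤ S →
      ∃ B₁ : ℝ, 0 ≤ B₁ ∧ ∃ Nr : ℕ,
      ∀ (ρ : ℕ) (a Cr : ℝ), 0 < Cr → 12 * ((ρ : ℝ) + (M : ℝ)) * a ≤ Cr →
        16 * 3800 * ((5 * L : ℕ) : ℝ) ^ 2 * (L : ℝ) * ((B₁ + 1) * a) ≤ 1 →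
        ∀ F : T3Family, F.L = L → ∀ (n K : ℕ) (hnK : n < K), 2 * ρ + Nr ≤ F.L ^ (F.m + n) →
          ∀ (ε₀ ε₁ : ℝ), 0 < ε₁ → 0 < ε₀ → ε₀ ≤ a → Cr * ε₁ ≤ ε₀ →
          ∀ V : GaugeField (F.P n) 0 (Matrix.specialUnitaryGroup (Fin 2) ℂ), PlaqSmall ε₁ V →
            ∀ U ∈ regFibrePr F n K hnK.le ε₀ V, ∀ x : Site (F.P K) 0,
              P1FlatPillarAt' F n K (cubeSeqMT3 F n K x ρ S M hM) (cubeSetM x (K - n) ρ S M 0) x ε₀ ε₁ B₁ 6 (8 * (L : ℝ) * (B₁ + 1)) U)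
    (hCEstat : ∀ L : ℕ, Odd L → 1 < L → ∀ (R₀ M₀ : ℕ) (B₀ δ₀ B₃ : ℝ), 0 < B₀ → 0 < δ₀ → 0 < B₃ → FlatOpsAdmAtMS L R₀ M₀ B₀ δ₀ B₃ →
      ∃ (M₁ R₁ : ℕ), ∀ (R M aₑ S : ℕ) (hM : 1 ≤ M), M = L ^ aₑ → M₁ ≤ M → M₀ ≤ M → R₁ ≤ R → R₀ ≤ R → R * M ≤ S →
      ∀ B₁ : ℝ, 0 ≤ B₁ →
      ∃ (Nce : ℕ) (K₁ K₂ C₂ Cce aCE : ℝ), 0 ≤ K₁ ∧ 0 ≤ K₂ ∧ 0 ≤ C₂ ∧ 0 ≤ Cce ∧ 0 < aCE ∧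
      ∀ ρ : ℕ, 1 ≤ ρ → ∀ F : T3Family, F.L = L → ∀ (n K : ℕ) (hnK : n < K), Nce ≤ F.L ^ (F.m + n) →
        ∀ (ε₀ ε₁ : ℝ), 0 < ε₁ → 0 < ε₀ → ε₀ ≤ aCE → Cce * ε₁ ≤ ε₀ →
        ∀ V : GaugeField (F.P n) 0 (Matrix.specialUnitaryGroup (Fin 2) ℂ), PlaqSmall ε₁ V →
          ∀ U ∈ regFibrePr F n K hnK.le ε₀ V,
            (∀ γ : ℝ → GaugeField (F.P K) 0 (Matrix.specialUnitaryGroup (Fin 2) ℂ), γ 0 = U → (∀ t, γ t ∈ fibre F ℰp n K hnK.le V) →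
              (∀ b, DifferentiableAt ℝ (fun t => ((γ t b : Matrix.specialUnitaryGroup (Fin 2) ℂ) : Matrix (Fin 2) (Fin 2) ℂ)) 0) →
                deriv (fun t => wilsonAction4 (γ t)) 0 = 0) →
            ∀ (x : Site (F.P K) 0) (C₂' : ℝ) (u : GaugeTransf (F.P K) 0 (Matrix.unitaryGroup (Fin 2) ℂ)) (A : PBond (F.P K) 0 → Matrix (Fin 2) (Fin 2) ℂ),
              -- the seven conjuncts of `P1FlatPillarAt' F n K (cubeSeqMT3 …) (cubeSetM x (K−n) ρ S M 0) x ε₀ ε₁ B₁ 6 C₂' U` for THIS pair `(u, A)` ((ii′) on `□₀`)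
              DP1Clause F n K (cubeSeqMT3 F n K x ρ S M hM) x U u →
              (∀ b : PBond (F.P K) 0, IsSelfAdjoint (A b)) → (∀ b : PBond (F.P K) 0, Matrix.trace (A b) = 0) →
              (∀ (z : B7Prop1Explicit.Site (F.P K).d) (μ : Fin (F.P K).d),
                transl (0 : Site (F.P K) 0) z ∈ cubeSetM x (K - n) ρ S M 0 → (transl (0 : Site (F.P K) 0) z).shift μ ∈ cubeSetM x (K - n) ρ S M 0 →
                (Unitary.toUnits (u (transl 0 z)))⁻¹ * unitsField (toUField U) ⟨transl 0 z, μ⟩ * Unitary.toUnits (u ((transl 0 z).shift μ)) =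
                  expUnit (I • ((((F.L : ℝ)⁻¹) ^ (K - n)) • A ⟨transl 0 z, μ⟩))) →
              (∀ w : ℕ → PBond (F.P K) 0 → ℝ, IsLevWeight F n K (cubeSeqMT3 F n K x ρ S M hM) w →
                (∀ b : PBond (F.P K) 0, w 1 b * ‖A b‖ ≤ B₁ * ε₀) ∧
                (∀ (b : PBond (F.P K) 0) (ν : Fin (F.P K).d), w 2 b * (F.L : ℝ) ^ (K - n) * ‖A ⟨b.src.shift ν, b.dir⟩ - A b‖ ≤ B₁ * ε₀)) →
              (∃ μ : SiteIdx (cubeSeqMT3 F n K x ρ S M hM) → Matrix (Fin 2) (Fin 2) ℂ, ∀ s : Site (F.P K) 0,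
                laplace ((F.L : ℝ) ^ (K - n)) (diverg ((F.L : ℝ) ^ (K - n)) A) s =
                  ∑ i : SiteIdx (cubeSeqMT3 F n K x ρ S M hM), siteAvgIter (i.1.1 : ℕ) (Pi.single s (1 : ℝ)) i.1.2 • μ i) →
              (∀ c : BondIdx (cubeSeqMT3 F n K x ρ S M hM), (c.1.1 : ℕ) = K - n →
                c.1.2.src ∈ (cubeSeqMT3 F n K x ρ S M hM).Om (c.1.1 : ℕ) → c.1.2.tgt ∈ (cubeSeqMT3 F n K x ρ S M hM).Om (c.1.1 : ℕ) →
                ‖chartLogFlat (((F.L : ℝ)⁻¹) ^ (K - n)) (cubeSeqMT3 F n K x ρ S M hM) A c‖ ≤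
                  6 * ε₁ * (distSite (Mk (F.P K) (c.1.1 : ℕ)) c.1.2.src (iterBlockOf (c.1.1 : ℕ) x) + 1)) →
              (∀ c : BondIdx (cubeSeqMT3 F n K x ρ S M hM), ‖chartLogFlat (((F.L : ℝ)⁻¹) ^ (K - n)) (cubeSeqMT3 F n K x ρ S M hM) A c‖ ≤ C₂' * ε₀) →
              -- OUTPUT: `sitePackage_of_rows`'s rows for some `Hs`, `C`, `e₁`, `e₃`
              ∃ (Hs : (BondIdx (cubeSeqMT3 F n K x ρ S M hM) → Matrix (Fin 2) (Fin 2) ℂ) → (PBond (F.P K) 0 → Matrix (Fin 2) (Fin 2) ℂ))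
                (C : (PBond (F.P K) 0 → Matrix (Fin 2) (Fin 2) ℂ) → (BondIdx (cubeSeqMT3 F n K x ρ S M hM) → Matrix (Fin 2) (Fin 2) ℂ))
                (e₁ e₃ : ℝ),
                ((∀ (z : B7Prop1Explicit.Site (F.P K).d) (τ : Fin (F.P K).d),
                    SideTouches (pullDom (fun j => if K - n ≤ j then ({x} : Set (Site (F.P K) 0)) else (∅ : Set (Site (F.P K) 0))) (K - n)) z τ →
                    ‖((A + Hs (C A)) - fun b : PBond (F.P K) 0 => ∑ c, flatH F n K (cubeSeqMT3 F n K x ρ S M hM) (Pi.single c 1) b •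
                        bondAvgIter (c.1.1 : ℕ) (A + Hs (C A)) c.1.2) ⟨transl 0 z, τ⟩‖ ≤ e₁) ∧
                  (∀ (z : B7Prop1Explicit.Site (F.P K).d) (κ τ : Fin (F.P K).d),
                    SideTouches (pullDom (fun j => if K - n ≤ j then ({x} : Set (Site (F.P K) 0)) else (∅ : Set (Site (F.P K) 0))) (K - n)) z τ →
                    ‖(((F.L : ℝ)⁻¹) ^ (K - n))⁻¹ •
                      (((A + Hs (C A)) - fun b : PBond (F.P K) 0 => ∑ c, flatH F n K (cubeSeqMT3 F n K x ρ S M hM) (Pi.single c 1) b •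
                          bondAvgIter (c.1.1 : ℕ) (A + Hs (C A)) c.1.2) ⟨(transl 0 z).shift κ, τ⟩ -
                        ((A + Hs (C A)) - fun b : PBond (F.P K) 0 => ∑ c, flatH F n K (cubeSeqMT3 F n K x ρ S M hM) (Pi.single c 1) b •
                          bondAvgIter (c.1.1 : ℕ) (A + Hs (C A)) c.1.2) ⟨transl 0 z, τ⟩)‖ ≤ e₁) ∧
                  (∀ (z : B7Prop1Explicit.Site (F.P K).d) (μ : Fin (F.P K).d),
                    BondTouches (pullDom (fun j => if K - n ≤ j then ({x} : Set (Site (F.P K) 0)) else (∅ : Set (Site (F.P K) 0))) (K - n)) z μ →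
                    ‖pdiv (((F.L : ℝ)⁻¹) ^ (K - n)) (1 : B7Prop1Explicit.Site (F.P K).d → Fin (F.P K).d → (Matrix (Fin 2) (Fin 2) ℂ)ˣ)
                        (plaqCovDeriv (((F.L : ℝ)⁻¹) ^ (K - n)) (1 : B7Prop1Explicit.Site (F.P K).d → Fin (F.P K).d → (Matrix (Fin 2) (Fin 2) ℂ)ˣ)
                          (pull ((A + Hs (C A)) - fun b : PBond (F.P K) 0 => ∑ c, flatH F n K (cubeSeqMT3 F n K x ρ S M hM) (Pi.single c 1) b •
                            bondAvgIter (c.1.1 : ℕ) (A + Hs (C A)) c.1.2) 0)) μ z‖ ≤ e₁)) ∧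
                ((∀ (z : B7Prop1Explicit.Site (F.P K).d) (τ : Fin (F.P K).d),
                    SideTouches (pullDom (fun j => if K - n ≤ j then ({x} : Set (Site (F.P K) 0)) else (∅ : Set (Site (F.P K) 0))) (K - n)) z τ →
                    ‖Hs (C A) ⟨transl 0 z, τ⟩‖ ≤ e₃) ∧
                  (∀ (z : B7Prop1Explicit.Site (F.P K).d) (κ τ : Fin (F.P K).d),
                    SideTouches (pullDom (fun j => if K - n ≤ j then ({x} : Set (Site (F.P K) 0)) else (∅ : Set (Site (F.P K) 0))) (K - n)) z τ →
                    ‖(((F.L : ℝ)⁻¹) ^ (K - n))⁻¹ • (Hs (C A) ⟨(transl 0 z).shift κ, τ⟩ - Hs (C A) ⟨transl 0 z, τ⟩)‖ ≤ e₃) ∧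
                  (∀ (z : B7Prop1Explicit.Site (F.P K).d) (μ : Fin (F.P K).d),
                    BondTouches (pullDom (fun j => if K - n ≤ j then ({x} : Set (Site (F.P K) 0)) else (∅ : Set (Site (F.P K) 0))) (K - n)) z μ →
                    ‖pdiv (((F.L : ℝ)⁻¹) ^ (K - n)) (1 : B7Prop1Explicit.Site (F.P K).d → Fin (F.P K).d → (Matrix (Fin 2) (Fin 2) ℂ)ˣ)
                        (plaqCovDeriv (((F.L : ℝ)⁻¹) ^ (K - n)) (1 : B7Prop1Explicit.Site (F.P K).d → Fin (F.P K).d → (Matrix (Fin 2) (Fin 2) ℂ)ˣ)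
                          (pull (Hs (C A)) 0)) μ z‖ ≤ e₃)) ∧
                (∀ c : BondIdx (cubeSeqMT3 F n K x ρ S M hM), (c.1.1 : ℕ) = K - n →
                  c.1.2.src ∈ (cubeSeqMT3 F n K x ρ S M hM).Om (c.1.1 : ℕ) → c.1.2.tgt ∈ (cubeSeqMT3 F n K x ρ S M hM).Om (c.1.1 : ℕ) →
                  ‖bondAvgIter (c.1.1 : ℕ) (A + Hs (C A)) c.1.2‖ ≤ 6 * ε₁ * (distSite (Mk (F.P K) (c.1.1 : ℕ)) c.1.2.src (iterBlockOf (c.1.1 : ℕ) x) + 1)) ∧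
                (∀ c : BondIdx (cubeSeqMT3 F n K x ρ S M hM),
                  ¬ ((c.1.1 : ℕ) = K - n ∧ c.1.2.src ∈ (cubeSeqMT3 F n K x ρ S M hM).Om (c.1.1 : ℕ) ∧
                      c.1.2.tgt ∈ (cubeSeqMT3 F n K x ρ S M hM).Om (c.1.1 : ℕ)) →
                  ‖bondAvgIter (c.1.1 : ℕ) (A + Hs (C A)) c.1.2‖ ≤ C₂ * ε₀ * (F.L : ℝ) ^ ((K - n) - (c.1.1 : ℕ))) ∧
                e₁ ≤ K₁ * ε₀ ^ 2 ∧ e₃ ≤ K₂ * ε₀ ^ 2) :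
    ∀ (L : ℕ), 1 < L → ∃ B₃ : ℝ, 4 < B₃ ∧ ∃ a₅ : ℝ, 0 < a₅ ∧ ∃ N : ℕ,
      ∀ (i : Idx L), N ≤ (i.1.1).L ^ ((i.1.1).m + i.1.2.1) → ∀ (ε₀ ε₁ : ℝ), 0 < ε₁ → ∀ (V : (famX L i).Bdry) (U : (famX L i).Cfg),
        (famX L i).Reg7 ε₁ V → (famX L i).InU ε₀ U → (famX L i).InB V U →
        (∀ γ : ℝ → GaugeField ((i.1.1).P i.1.2.2) 0 (Matrix.specialUnitaryGroup (Fin 2) ℂ), γ 0 = U → (∀ t, γ t ∈ fibre i.1.1 ℰp i.1.2.1 i.1.2.2 i.2.2.le V) →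
          (∀ b, DifferentiableAt ℝ (fun t => ((γ t b : Matrix.specialUnitaryGroup (Fin 2) ℂ) : Matrix (Fin 2) (Fin 2) ℂ)) 0) →
            deriv (fun t => wilsonAction4 (γ t)) 0 = 0) → ε₀ ≤ a₅ →
          (famX L i).InU (max (B₃ * ε₁) (ε₀ / 2)) U :=
  roomStubTextStat_of_roomHalvingStat (roomHalvingStat_of_rows hP2 hP1room hCEstat)

/-! ## §8 Door v3 is the stronger door -/

/-- **`RoomHalvingTextStat ⇒ RoomHalvingText`** (LEAD-H L-7 (1)): minimality over print's open regular fibre at some radius (the carrier's `IsCritical` = `IsCritR2`) implies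
stationarity of the Wilson action along every bondwise-differentiable exact-fibre curve through `U` (✓`Prop7CritEL.deriv_comp_eq_zero_of_isCritR2`; continuity of the
curve from bondwise differentiability, ✓`continuousAt_of_differentiableAt_bonds`) — so the stationarity-currency room-stub text implies door v2's `RoomHalvingText`, same
constants. [cite: Balaban1985Variational, (111) p.294, p.300] -/
theorem roomHalvingText_of_stat
    (H : ∀ (L : ℕ), 1 < L → ∃ B₃ : ℝ, 4 < B₃ ∧ ∃ a₅ : ℝ, 0 < a₅ ∧ ∃ N : ℕ,
      ∀ (i : Idx L), N ≤ (i.1.1).L ^ ((i.1.1).m + i.1.2.1) → ∀ (ε₀ ε₁ : ℝ), 0 < ε₁ → ∀ (V : (famX L i).Bdry) (U : (famX L i).Cfg),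
        (famX L i).Reg7 ε₁ V → (famX L i).InU ε₀ U → (famX L i).InB V U →
        (∀ γ : ℝ → GaugeField ((i.1.1).P i.1.2.2) 0 (Matrix.specialUnitaryGroup (Fin 2) ℂ), γ 0 = U → (∀ t, γ t ∈ fibre i.1.1 ℰp i.1.2.1 i.1.2.2 i.2.2.le V) →
          (∀ b, DifferentiableAt ℝ (fun t => ((γ t b : Matrix.specialUnitaryGroup (Fin 2) ℂ) : Matrix (Fin 2) (Fin 2) ℂ)) 0) →
            deriv (fun t => wilsonAction4 (γ t)) 0 = 0) → ε₀ ≤ a₅ →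
          (famX L i).InU (max (B₃ * ε₁) (ε₀ / 2)) U) :
    ∀ (L : ℕ), 1 < L → ∃ B₃ : ℝ, 4 < B₃ ∧ ∃ a₅ : ℝ, 0 < a₅ ∧ ∃ N : ℕ,
      ∀ (i : Idx L), N ≤ (i.1.1).L ^ ((i.1.1).m + i.1.2.1) → ∀ (ε₀ ε₁ : ℝ), 0 < ε₁ → ∀ (V : (famX L i).Bdry) (U : (famX L i).Cfg),
        (famX L i).Reg7 ε₁ V → (famX L i).InU ε₀ U → (famX L i).InB V U → (famX L i).IsCritical V U → ε₀ ≤ a₅ →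
          (famX L i).InU (max (B₃ * ε₁) (ε₀ / 2)) U := by
  intro L hL
  obtain ⟨B₃, hB₃, a₅, ha₅, N, h⟩ := H L hL
  refine ⟨B₃, hB₃, a₅, ha₅, N, ?_⟩
  rintro ⟨⟨F, n, K⟩, hF, hnK⟩ hN ε₀ ε₁ hε₁ V U hV hU hB hcrit hε₀
  have hnK' : n < K := hnK
  have hcrit' : IsCritR2 F n K hnK'.le V U := hcrit
  exact h ⟨(F, n, K), hF, hnK⟩ hN ε₀ ε₁ hε₁ V U hV hU hB
    (fun γ hγ0 hγfib hγd => deriv_comp_eq_zero_of_isCritR2 hcrit' γ hγ0 hγfib (continuousAt_of_differentiableAt_bonds γ hγd)) hε₀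


/-! ## §9 The door v3 with the P2 text discharged -/

/-- ★★★ **THE DOOR v3 WITH THE P2 TEXT DISCHARGED** (✓`FlatOpsAdmAtMSAllL.hP2_holds`, ★w1-20520 g6's ✓p625735): from `hP1room` and `hCEstat` alone, `RoomHalvingTextStat L`
for every `L` — the H-door's displayed debt in stationarity currency is exactly {hP1room, hCEstat}.
[cite: Balaban1985Variational, (111) p.294, (152)-(168) pp.301-304, Prop. 8 p.304; Balaban1985RegularSpaces, Thm 2 p.83; Balaban1984PropagatorsII, Sect. 2 pp.224-226] -/
theorem halvingStep_of_rows_roomStat₂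
    (hP1room : ∀ L : ℕ, Odd L → 1 < L → ∃ (Mₚ Rₚ : ℕ), ∀ (R M aₑ S : ℕ) (hM : 1 ≤ M), M = L ^ aₑ → Mₚ ≤ M → Rₚ ≤ R → R * M ≤ S →
      ∃ B₁ : ℝ, 0 ≤ B₁ ∧ ∃ Nr : ℕ,
      ∀ (ρ : ℕ) (a Cr : ℝ), 0 < Cr → 12 * ((ρ : ℝ) + (M : ℝ)) * a ≤ Cr →
        16 * 3800 * ((5 * L : ℕ) : ℝ) ^ 2 * (L : ℝ) * ((B₁ + 1) * a) ≤ 1 →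
        ∀ F : T3Family, F.L = L → ∀ (n K : ℕ) (hnK : n < K), 2 * ρ + Nr ≤ F.L ^ (F.m + n) →
          ∀ (ε₀ ε₁ : ℝ), 0 < ε₁ → 0 < ε₀ → ε₀ ≤ a → Cr * ε₁ ≤ ε₀ →
          ∀ V : GaugeField (F.P n) 0 (Matrix.specialUnitaryGroup (Fin 2) ℂ), PlaqSmall ε₁ V →
            ∀ U ∈ regFibrePr F n K hnK.le ε₀ V, ∀ x : Site (F.P K) 0,
              P1FlatPillarAt' F n K (cubeSeqMT3 F n K x ρ S M hM) (cubeSetM x (K - n) ρ S M 0) x ε₀ ε₁ B₁ 6 (8 * (L : ℝ) * (B₁ + 1)) U)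
    (hCEstat : ∀ L : ℕ, Odd L → 1 < L → ∀ (R₀ M₀ : ℕ) (B₀ δ₀ B₃ : ℝ), 0 < B₀ → 0 < δ₀ → 0 < B₃ → FlatOpsAdmAtMS L R₀ M₀ B₀ δ₀ B₃ →
      ∃ (M₁ R₁ : ℕ), ∀ (R M aₑ S : ℕ) (hM : 1 ≤ M), M = L ^ aₑ → M₁ ≤ M → M₀ ≤ M → R₁ ≤ R → R₀ ≤ R → R * M ≤ S →
      ∀ B₁ : ℝ, 0 ≤ B₁ →
      ∃ (Nce : ℕ) (K₁ K₂ C₂ Cce aCE : ℝ), 0 ≤ K₁ ∧ 0 ≤ K₂ ∧ 0 ≤ C₂ ∧ 0 ≤ Cce ∧ 0 < aCE ∧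
      ∀ ρ : ℕ, 1 ≤ ρ → ∀ F : T3Family, F.L = L → ∀ (n K : ℕ) (hnK : n < K), Nce ≤ F.L ^ (F.m + n) →
        ∀ (ε₀ ε₁ : ℝ), 0 < ε₁ → 0 < ε₀ → ε₀ ≤ aCE → Cce * ε₁ ≤ ε₀ →
        ∀ V : GaugeField (F.P n) 0 (Matrix.specialUnitaryGroup (Fin 2) ℂ), PlaqSmall ε₁ V →
          ∀ U ∈ regFibrePr F n K hnK.le ε₀ V,
            (∀ γ : ℝ → GaugeField (F.P K) 0 (Matrix.specialUnitaryGroup (Fin 2) ℂ), γ 0 = U → (∀ t, γ t ∈ fibre F ℰp n K hnK.le V) →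
              (∀ b, DifferentiableAt ℝ (fun t => ((γ t b : Matrix.specialUnitaryGroup (Fin 2) ℂ) : Matrix (Fin 2) (Fin 2) ℂ)) 0) →
                deriv (fun t => wilsonAction4 (γ t)) 0 = 0) →
            ∀ (x : Site (F.P K) 0) (C₂' : ℝ) (u : GaugeTransf (F.P K) 0 (Matrix.unitaryGroup (Fin 2) ℂ)) (A : PBond (F.P K) 0 → Matrix (Fin 2) (Fin 2) ℂ),
              -- the seven conjuncts of `P1FlatPillarAt' F n K (cubeSeqMT3 …) (cubeSetM x (K−n) ρ S M 0) x ε₀ ε₁ B₁ 6 C₂' U` for THIS pair `(u, A)` ((ii′) on `□₀`)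
              DP1Clause F n K (cubeSeqMT3 F n K x ρ S M hM) x U u →
              (∀ b : PBond (F.P K) 0, IsSelfAdjoint (A b)) → (∀ b : PBond (F.P K) 0, Matrix.trace (A b) = 0) →
              (∀ (z : B7Prop1Explicit.Site (F.P K).d) (μ : Fin (F.P K).d),
                transl (0 : Site (F.P K) 0) z ∈ cubeSetM x (K - n) ρ S M 0 → (transl (0 : Site (F.P K) 0) z).shift μ ∈ cubeSetM x (K - n) ρ S M 0 →
                (Unitary.toUnits (u (transl 0 z)))⁻¹ * unitsField (toUField U) ⟨transl 0 z, μ⟩ * Unitary.toUnits (u ((transl 0 z).shift μ)) =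
                  expUnit (I • ((((F.L : ℝ)⁻¹) ^ (K - n)) • A ⟨transl 0 z, μ⟩))) →
              (∀ w : ℕ → PBond (F.P K) 0 → ℝ, IsLevWeight F n K (cubeSeqMT3 F n K x ρ S M hM) w →
                (∀ b : PBond (F.P K) 0, w 1 b * ‖A b‖ ≤ B₁ * ε₀) ∧
                (∀ (b : PBond (F.P K) 0) (ν : Fin (F.P K).d), w 2 b * (F.L : ℝ) ^ (K - n) * ‖A ⟨b.src.shift ν, b.dir⟩ - A b‖ ≤ B₁ * ε₀)) →
              (∃ μ : SiteIdx (cubeSeqMT3 F n K x ρ S M hM) → Matrix (Fin 2) (Fin 2) ℂ, ∀ s : Site (F.P K) 0,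
                laplace ((F.L : ℝ) ^ (K - n)) (diverg ((F.L : ℝ) ^ (K - n)) A) s =
                  ∑ i : SiteIdx (cubeSeqMT3 F n K x ρ S M hM), siteAvgIter (i.1.1 : ℕ) (Pi.single s (1 : ℝ)) i.1.2 • μ i) →
              (∀ c : BondIdx (cubeSeqMT3 F n K x ρ S M hM), (c.1.1 : ℕ) = K - n →
                c.1.2.src ∈ (cubeSeqMT3 F n K x ρ S M hM).Om (c.1.1 : ℕ) → c.1.2.tgt ∈ (cubeSeqMT3 F n K x ρ S M hM).Om (c.1.1 : ℕ) →
                ‖chartLogFlat (((F.L : ℝ)⁻¹) ^ (K - n)) (cubeSeqMT3 F n K x ρ S M hM) A c‖ ≤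
                  6 * ε₁ * (distSite (Mk (F.P K) (c.1.1 : ℕ)) c.1.2.src (iterBlockOf (c.1.1 : ℕ) x) + 1)) →
              (∀ c : BondIdx (cubeSeqMT3 F n K x ρ S M hM), ‖chartLogFlat (((F.L : ℝ)⁻¹) ^ (K - n)) (cubeSeqMT3 F n K x ρ S M hM) A c‖ ≤ C₂' * ε₀) →
              -- OUTPUT: `sitePackage_of_rows`'s rows for some `Hs`, `C`, `e₁`, `e₃`
              ∃ (Hs : (BondIdx (cubeSeqMT3 F n K x ρ S M hM) → Matrix (Fin 2) (Fin 2) ℂ) → (PBond (F.P K) 0 → Matrix (Fin 2) (Fin 2) ℂ))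
                (C : (PBond (F.P K) 0 → Matrix (Fin 2) (Fin 2) ℂ) → (BondIdx (cubeSeqMT3 F n K x ρ S M hM) → Matrix (Fin 2) (Fin 2) ℂ))
                (e₁ e₃ : ℝ),
                ((∀ (z : B7Prop1Explicit.Site (F.P K).d) (τ : Fin (F.P K).d),
                    SideTouches (pullDom (fun j => if K - n ≤ j then ({x} : Set (Site (F.P K) 0)) else (∅ : Set (Site (F.P K) 0))) (K - n)) z τ →
                    ‖((A + Hs (C A)) - fun b : PBond (F.P K) 0 => ∑ c, flatH F n K (cubeSeqMT3 F n K x ρ S M hM) (Pi.single c 1) b •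
                        bondAvgIter (c.1.1 : ℕ) (A + Hs (C A)) c.1.2) ⟨transl 0 z, τ⟩‖ ≤ e₁) ∧
                  (∀ (z : B7Prop1Explicit.Site (F.P K).d) (κ τ : Fin (F.P K).d),
                    SideTouches (pullDom (fun j => if K - n ≤ j then ({x} : Set (Site (F.P K) 0)) else (∅ : Set (Site (F.P K) 0))) (K - n)) z τ →
                    ‖(((F.L : ℝ)⁻¹) ^ (K - n))⁻¹ •
                      (((A + Hs (C A)) - fun b : PBond (F.P K) 0 => ∑ c, flatH F n K (cubeSeqMT3 F n K x ρ S M hM) (Pi.single c 1) b •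
                          bondAvgIter (c.1.1 : ℕ) (A + Hs (C A)) c.1.2) ⟨(transl 0 z).shift κ, τ⟩ -
                        ((A + Hs (C A)) - fun b : PBond (F.P K) 0 => ∑ c, flatH F n K (cubeSeqMT3 F n K x ρ S M hM) (Pi.single c 1) b •
                          bondAvgIter (c.1.1 : ℕ) (A + Hs (C A)) c.1.2) ⟨transl 0 z, τ⟩)‖ ≤ e₁) ∧
                  (∀ (z : B7Prop1Explicit.Site (F.P K).d) (μ : Fin (F.P K).d),
                    BondTouches (pullDom (fun j => if K - n ≤ j then ({x} : Set (Site (F.P K) 0)) else (∅ : Set (Site (F.P K) 0))) (K - n)) z μ →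
                    ‖pdiv (((F.L : ℝ)⁻¹) ^ (K - n)) (1 : B7Prop1Explicit.Site (F.P K).d → Fin (F.P K).d → (Matrix (Fin 2) (Fin 2) ℂ)ˣ)
                        (plaqCovDeriv (((F.L : ℝ)⁻¹) ^ (K - n)) (1 : B7Prop1Explicit.Site (F.P K).d → Fin (F.P K).d → (Matrix (Fin 2) (Fin 2) ℂ)ˣ)
                          (pull ((A + Hs (C A)) - fun b : PBond (F.P K) 0 => ∑ c, flatH F n K (cubeSeqMT3 F n K x ρ S M hM) (Pi.single c 1) b •
                            bondAvgIter (c.1.1 : ℕ) (A + Hs (C A)) c.1.2) 0)) μ z‖ ≤ e₁)) ∧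
                ((∀ (z : B7Prop1Explicit.Site (F.P K).d) (τ : Fin (F.P K).d),
                    SideTouches (pullDom (fun j => if K - n ≤ j then ({x} : Set (Site (F.P K) 0)) else (∅ : Set (Site (F.P K) 0))) (K - n)) z τ →
                    ‖Hs (C A) ⟨transl 0 z, τ⟩‖ ≤ e₃) ∧
                  (∀ (z : B7Prop1Explicit.Site (F.P K).d) (κ τ : Fin (F.P K).d),
                    SideTouches (pullDom (fun j => if K - n ≤ j then ({x} : Set (Site (F.P K) 0)) else (∅ : Set (Site (F.P K) 0))) (K - n)) z τ →
                    ‖(((F.L : ℝ)⁻¹) ^ (K - n))⁻¹ • (Hs (C A) ⟨(transl 0 z).shift κ, τ⟩ - Hs (C A) ⟨transl 0 z, τ⟩)‖ ≤ e₃) ∧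
                  (∀ (z : B7Prop1Explicit.Site (F.P K).d) (μ : Fin (F.P K).d),
                    BondTouches (pullDom (fun j => if K - n ≤ j then ({x} : Set (Site (F.P K) 0)) else (∅ : Set (Site (F.P K) 0))) (K - n)) z μ →
                    ‖pdiv (((F.L : ℝ)⁻¹) ^ (K - n)) (1 : B7Prop1Explicit.Site (F.P K).d → Fin (F.P K).d → (Matrix (Fin 2) (Fin 2) ℂ)ˣ)
                        (plaqCovDeriv (((F.L : ℝ)⁻¹) ^ (K - n)) (1 : B7Prop1Explicit.Site (F.P K).d → Fin (F.P K).d → (Matrix (Fin 2) (Fin 2) ℂ)ˣ)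
                          (pull (Hs (C A)) 0)) μ z‖ ≤ e₃)) ∧
                (∀ c : BondIdx (cubeSeqMT3 F n K x ρ S M hM), (c.1.1 : ℕ) = K - n →
                  c.1.2.src ∈ (cubeSeqMT3 F n K x ρ S M hM).Om (c.1.1 : ℕ) → c.1.2.tgt ∈ (cubeSeqMT3 F n K x ρ S M hM).Om (c.1.1 : ℕ) →
                  ‖bondAvgIter (c.1.1 : ℕ) (A + Hs (C A)) c.1.2‖ ≤ 6 * ε₁ * (distSite (Mk (F.P K) (c.1.1 : ℕ)) c.1.2.src (iterBlockOf (c.1.1 : ℕ) x) + 1)) ∧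
                (∀ c : BondIdx (cubeSeqMT3 F n K x ρ S M hM),
                  ¬ ((c.1.1 : ℕ) = K - n ∧ c.1.2.src ∈ (cubeSeqMT3 F n K x ρ S M hM).Om (c.1.1 : ℕ) ∧
                      c.1.2.tgt ∈ (cubeSeqMT3 F n K x ρ S M hM).Om (c.1.1 : ℕ)) →
                  ‖bondAvgIter (c.1.1 : ℕ) (A + Hs (C A)) c.1.2‖ ≤ C₂ * ε₀ * (F.L : ℝ) ^ ((K - n) - (c.1.1 : ℕ))) ∧
                e₁ ≤ K₁ * ε₀ ^ 2 ∧ e₃ ≤ K₂ * ε₀ ^ 2) :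
    ∀ (L : ℕ), 1 < L → ∃ B₃ : ℝ, 4 < B₃ ∧ ∃ a₅ : ℝ, 0 < a₅ ∧ ∃ N : ℕ,
      ∀ (i : Idx L), N ≤ (i.1.1).L ^ ((i.1.1).m + i.1.2.1) → ∀ (ε₀ ε₁ : ℝ), 0 < ε₁ → ∀ (V : (famX L i).Bdry) (U : (famX L i).Cfg),
        (famX L i).Reg7 ε₁ V → (famX L i).InU ε₀ U → (famX L i).InB V U →
        (∀ γ : ℝ → GaugeField ((i.1.1).P i.1.2.2) 0 (Matrix.specialUnitaryGroup (Fin 2) ℂ), γ 0 = U → (∀ t, γ t ∈ fibre i.1.1 ℰp i.1.2.1 i.1.2.2 i.2.2.le V) →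
          (∀ b, DifferentiableAt ℝ (fun t => ((γ t b : Matrix.specialUnitaryGroup (Fin 2) ℂ) : Matrix (Fin 2) (Fin 2) ℂ)) 0) →
            deriv (fun t => wilsonAction4 (γ t)) 0 = 0) → ε₀ ≤ a₅ →
          (famX L i).InU (max (B₃ * ε₁) (ε₀ / 2)) U :=
  halvingStep_of_rows_roomStat FlatOpsAdmAtMSAllL.hP2_holds hP1room hCEstat

end Door

end Summit.QuantumFields.YangMills.Theorems.HalvingStepOfPillarsRoomStatDoor

end
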